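import Summits.HubbardSuperconductivity.HubbardSuperconductivity.Theorems.AnisotropyChordTransferFibre3RowCLamIncrement
import Summits.HubbardSuperconductivity.HubbardSuperconductivity.Theorems.AnisotropyChordTransferFibre3RowCKernelSubadd
import Summits.HubbardSuperconductivity.HubbardSuperconductivity.Theorems.AnisotropyChordTransferFibre3GroundExplicit
import Summits.HubbardSuperconductivity.HubbardSuperconductivity.Theorems.AnisotropyChordTransferFibre3RowCGradSup
import Summits.HubbardSuperconductivity.HubbardSuperconductivity.Theorems.AnisotropyChordTransferFibre3RowCLamIncrement64

/-!
# Route `AnisotropyChord` / H0 rotor rung, row C (KT-2b) on the t-BLOCKS `64 ≤ L < 128`: block twin of `…AnisotropyChordTransferFibre3RowCGradSup`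

T-FORK (p1 g32, route-lead ruling R4-b; p2's inventory memo HOME/hubbard-h0-rotor-p2/TBLOCK-INVENTORY-g8.md §3–§4): the declarations of
`…RowCGradSup` that carry the hypothesis `128 ≤ L` (or a constant that changes below `L = 128`, or the `L2.NamedCell` cell box) restated in the
namespace `RowC.T` with the SAME names for the t-blocks (route-lead ruling R1): analytic layer with `64 ≤ L` and the `L ≥ 64` numerics of p2 g8
(`ManifoldA.nu_ceiling64` (ν < .0359), `manifold_band64`, `second_shell_window64` (±.0012/±.003), `RowC.fmax_uniform64`/`gmin_uniform64`
(same constant .07 + .1ν), `third_shell_window64` (±.0031/±.01), `window_k10_64` ([.24993, .25]), `lam_increment_bound64` (δ = .0022)); cell layer on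
block cells `c : L2.TCell` (`cellFinalBoxCB (c.box a₁ a₂)`, `pmem_xTrueT`, `RowC.finalVec_mem_of_cellFinalBoxT`).  Declarations that do not change are NOT
duplicated (they resolve to `RowC`); proofs are verbatim up to the substitutions.
Prover seat `hubbard-h0-rotor-p1` g32 (route lead); helper for piece A = stmt-HubbardSuperconductivity-23918 of rung 19089 (`--supports`, helper
class).  Nothing here proves superconductivity in the Hubbard model; lemmas for ONE row of ONE conditional reduction on the t-blocks; the rotor TARGET
as originally worded stays FALSE (g15 verdict).  Mathlib + the tree only; no sorry.
-/

set_option linter.dupNamespace false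
set_option autoImplicit false

noncomputable section

open scoped BigOperators

namespace Summit.HubbardSuperconductivity.HubbardSuperconductivity.Theorems.AnisotropyChord.Transfer.Fibre3

namespace RowC

namespace T

open RateLemma

variable (L : ℕ) [NeZero L]

/-- ★ the gradient sup bound (body of `GradSupBound`). [folklore] -/
theorem grad_sup_bound (hL : 64 ≤ L) {Δ lam2 : ℝ} {f : Tor L → ℝ} (hΔ0 : 0 ≤ Δ) (hΔ1 : Δ < 1)
    (hf : IsGroundTwoMagnon L Δ lam2 f) (hlam : lam2 ≤ 0.0513 * (2 * Real.pi / L) ^ 2)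
    {e : Tor L} (he : e ∈ nnList L) {b : Tor L} (hb : b ≠ 0) (hbe : b - e ≠ 0) :
    |Dgrad L f e b| ≤ etaEff L lam2 + 0.0022 * cS L Δ lam2 f := by
  have hL5 : 5 ≤ L := by omega
  have hpos := lam2_pos L (by omega) hΔ1 hf.1
  have hl2 := lam2_lt_two_eps1 L hL5 hΔ0 hf
  have hfnn : 0 < f (K1 L) := hf.1.2.2.1
  have hcs : 0 ≤ cS L Δ lam2 f := by
    have : 0 ≤ 4 * (1 - Δ) + Δ * lam2 := by nlinarith
    unfold cS; exact mul_nonneg hfnn.le this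
  -- the profile through the kernel
  have hPb := ground_profile_aKer L hL5 hΔ0 hΔ1 hf hb
  have hPbe := ground_profile_aKer L hL5 hΔ0 hΔ1 hf hbe
  have hPx := ground_profile_aKer L hL5 hΔ0 hΔ1 hf (K1_ne_zero L (by omega))
  -- `c_s a_λ(x̂) = η`
  have hη : cS L Δ lam2 f * aKer L lam2 (K1 L) = etaEff L lam2 := by
    rw [etaEff_eq L (by omega) hf.1]; linarith
  -- split `a_λ = a₀ + δ_λ`
  have hD : Dgrad L f e b = cS L Δ lam2 f * ((aKer L 0 b - aKer L 0 (b - e))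
      + (lamPart L lam2 b - lamPart L lam2 (b - e))) := by
    unfold Dgrad lamPart; rw [hPb, hPbe]; ring
  have h1 := abs_aKer_zero_sub_le L b e
  have h2 := lam_increment_bound64 L hL hpos.le hlam he b
  -- `a₀(e) ≤ a_λ(e) = a_λ(x̂)`
  have h3 : aKer L 0 e ≤ aKer L lam2 (K1 L) := by
    have hδ := (lamPartShellBound_holds L (by omega) lam2 hpos.le hl2 e).1
    unfold lamPart at hδ
    have hK : K1 L = ex L := rfl
    rw [hK, ← aKer_nn_eq L lam2 he]
    linarith
  rw [hD, abs_mul, abs_of_nonneg hcs]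
  have h4 : |aKer L 0 b - aKer L 0 (b - e) + (lamPart L lam2 b - lamPart L lam2 (b - e))|
      ≤ aKer L lam2 (K1 L) + 0.0022 := by
    refine (abs_add_le _ _).trans ?_
    linarith
  calc cS L Δ lam2 f * |aKer L 0 b - aKer L 0 (b - e) + (lamPart L lam2 b - lamPart L lam2 (b - e))|
      ≤ cS L Δ lam2 f * (aKer L lam2 (K1 L) + 0.0022) := mul_le_mul_of_nonneg_left h4 hcs
    _ = etaEff L lam2 + 0.0022 * cS L Δ lam2 f := by rw [mul_add, hη]; ring


end T

end RowC

end Summit.HubbardSuperconductivity.HubbardSuperconductivity.Theorems.AnisotropyChord.Transfer.Fibre3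

end
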